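import Mathlib
import HarnessLib

/-!
# Route `RadicialJung`, crux `CleanModels` (stmt-15917), line `Sketch`: certificate that the SMOOTH-CONE binder (rev 35) subsumes the MORSE binder (rev 34)

Line lead `res-B-lead-1` g10, `--supports stmt-ResolutionOfSingularities-15917`.  Sketch rev 34 narrowed the research stub by «¬∃ Morse stage» (quadratic form
`Σ a_ij t_i t_j` with polar forms spanning `𝔪/𝔪²`); rev 35 replaced it by «¬∃ stage with a SMOOTH homogeneous tangent cone of degree `e` prime to `p`» in the lifted
Jacobian form `∀ i ∃ b, b_l ∈ 𝔪^{N+1-e} ∧ t_i^N − Σ_l b_l (∂_l F)(t) ∈ 𝔪^{N+1}` (`e ≤ N + 1`).  This file is the kernel certificate that every Morse datum IS a smooth-cone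
datum with `F = Σ a_ij X_i X_j`, `e = 2`, `N = 1` (`(∂_l F)(t) = Σ_j (a_lj + a_jl) t_j`), so «¬∃ smooth-cone stage» implies «¬∃ Morse stage» and rev 35 is a NARROWING
of rev 34 (for `p ≠ 2`, the node hypothesis).  Pure algebra over a local ring; no valuation, no model.

Honest framing: OURS · counted 0 · bookkeeping certificate; nothing here proves resolution in characteristic `p`.
-/

noncomputable section

set_option linter.dupNamespace false

open IsLocalRing MvPolynomial

namespace Summit.ResolutionOfSingularities.ResolutionOfSingularities.Theorems.RadicialJung.CleanModels.ConeExit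

/-- The quadratic form `Σ a_ij X_i X_j` as a polynomial is homogeneous of degree `2`. [folklore] -/
theorem isHomogeneous_quadForm {R : Type*} [CommRing R] {d : ℕ} (a : Fin d → Fin d → R) :
    (∑ i : Fin d, ∑ j : Fin d, C (a i j) * X i * X j : MvPolynomial (Fin d) R).IsHomogeneous 2 := by
  refine IsHomogeneous.sum _ _ _ fun i _ => IsHomogeneous.sum _ _ _ fun j _ => ?_
  have h := ((isHomogeneous_C (Fin d) (a i j)).mul (isHomogeneous_X R i)).mul (isHomogeneous_X R j)
  simpa using h

/-- Evaluating `Σ a_ij X_i X_j` at `t` gives `Σ a_ij t_i t_j`. [folklore] -/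
theorem aeval_quadForm {R : Type*} [CommRing R] {d : ℕ} (a : Fin d → Fin d → R) (t : Fin d → R) :
    aeval t (∑ i : Fin d, ∑ j : Fin d, C (a i j) * X i * X j : MvPolynomial (Fin d) R) = ∑ i, ∑ j, a i j * t i * t j := by
  simp [map_sum]

/-- The polars: `(∂_l Σ a_ij X_i X_j)(t) = Σ_j (a_lj + a_jl) t_j`. [folklore] -/
theorem aeval_pderiv_quadForm {R : Type*} [CommRing R] {d : ℕ} (a : Fin d → Fin d → R) (t : Fin d → R) (l : Fin d) :
    aeval t (pderiv l (∑ i : Fin d, ∑ j : Fin d, C (a i j) * X i * X j : MvPolynomial (Fin d) R)) = ∑ j, (a l j + a j l) * t j := by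
  classical
  have hD : ∀ i j : Fin d, aeval t (pderiv l (C (a i j) * X i * X j : MvPolynomial (Fin d) R)) =
      (if j = l then a i j * t i else 0) + (if i = l then a i j * t j else 0) := by
    intro i j
    rw [Derivation.leibniz, Derivation.leibniz, pderiv_C, smul_zero, add_zero, smul_eq_mul, smul_eq_mul, pderiv_X, pderiv_X]
    simp only [Pi.single_apply, map_add, map_mul, aeval_C, aeval_X]
    split_ifs <;> simp <;> ring
  simp only [map_sum, hD, Finset.sum_add_distrib]
  have h1 : ∀ i : Fin d, (∑ j : Fin d, if j = l then a i j * t i else 0) = a i l * t i :=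
    fun i => by rw [Finset.sum_ite_eq' Finset.univ l (fun j => a i j * t i)]; simp
  have h2 : (∑ i : Fin d, ∑ j : Fin d, if i = l then a i j * t j else 0) = ∑ j, a l j * t j := by
    rw [Finset.sum_comm]
    refine Finset.sum_congr rfl fun j _ => ?_
    rw [Finset.sum_ite_eq' Finset.univ l (fun i => a i j * t j)]; simp
  simp only [h1, h2, add_mul, Finset.sum_add_distrib]
  rw [add_comm]

/-- **Every MORSE datum is a SMOOTH-CONE datum** (`F = Σ a_ij X_i X_j`, `e = 2`, `N = 1`): the certificate that the rev-35 binder of the research stub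
`stub_cleanLU3DefectNonDiscrete` implies the rev-34 binder, i.e. Sketch rev 35 narrows rev 34 (given `p ∤ 2`). [folklore] -/
theorem smoothConeData_of_morseData {R : Type} [CommRing R] [IsLocalRing R] {p d : ℕ} (hp2 : ¬ p ∣ 2)
    (t : Fin d → R) (a : Fin d → Fin d → R) (h : R)
    (hQ : h - ∑ i, ∑ j, a i j * t i * t j ∈ maximalIdeal R ^ 3)
    (hJ : ∀ i, t i ∈ Ideal.span (Set.range fun k => ∑ j, (a k j + a j k) * t j) ⊔ maximalIdeal R ^ 2) :
    ∃ (F : MvPolynomial (Fin d) R) (e N : ℕ) (_ : F.IsHomogeneous e) (_ : ¬ p ∣ e) (_ : e ≤ N + 1),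
      h - MvPolynomial.aeval t F ∈ maximalIdeal R ^ (e + 1) ∧
      ∀ i, ∃ b : Fin d → R, (∀ l, b l ∈ maximalIdeal R ^ (N + 1 - e)) ∧
        t i ^ N - ∑ l, b l * MvPolynomial.aeval t (MvPolynomial.pderiv l F) ∈ maximalIdeal R ^ (N + 1) := by
  classical
  refine ⟨∑ i : Fin d, ∑ j : Fin d, C (a i j) * X i * X j, 2, 1, isHomogeneous_quadForm a, hp2, by norm_num, ?_, fun i => ?_⟩
  · rw [aeval_quadForm]; exact hQ
  · obtain ⟨y, hy, m, hm, hym⟩ := Submodule.mem_sup.mp (hJ i)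
    obtain ⟨b, hb⟩ := Ideal.mem_span_range_iff_exists_fun.mp hy
    refine ⟨b, fun l => by simp, ?_⟩
    simp_rw [aeval_pderiv_quadForm]
    rw [pow_one, hb]
    have : t i - y = m := by rw [← hym]; ring
    rw [this]
    simpa using hm

/-- **The rev-35 binder implies the rev-34 binder** (contrapositive form, for any predicate `P` on the common data: model, representative, regular system of parameters):
if NO smooth-cone datum exists then NO Morse datum exists. [folklore] -/
theorem no_morse_of_no_smoothCone {R : Type} [CommRing R] [IsLocalRing R] {p d : ℕ} (hp2 : ¬ p ∣ 2) (t : Fin d → R) (h : R)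
    (hno : ¬ ∃ (F : MvPolynomial (Fin d) R) (e N : ℕ) (_ : F.IsHomogeneous e) (_ : ¬ p ∣ e) (_ : e ≤ N + 1),
      h - MvPolynomial.aeval t F ∈ maximalIdeal R ^ (e + 1) ∧
      ∀ i, ∃ b : Fin d → R, (∀ l, b l ∈ maximalIdeal R ^ (N + 1 - e)) ∧
        t i ^ N - ∑ l, b l * MvPolynomial.aeval t (MvPolynomial.pderiv l F) ∈ maximalIdeal R ^ (N + 1)) :
    ¬ ∃ (a : Fin d → Fin d → R), h - ∑ i, ∑ j, a i j * t i * t j ∈ maximalIdeal R ^ 3 ∧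
      ∀ i, t i ∈ Ideal.span (Set.range fun k => ∑ j, (a k j + a j k) * t j) ⊔ maximalIdeal R ^ 2 := by
  rintro ⟨a, hQ, hJ⟩
  exact hno (smoothConeData_of_morseData hp2 t a h hQ hJ)

end Summit.ResolutionOfSingularities.ResolutionOfSingularities.Theorems.RadicialJung.CleanModels.ConeExit

end
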